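import Summits.BirchSwinnertonDyer.BirchSwinnertonDyer.Theorems.ResidualThetaTransportAtTwoSignedMuSeedAtTwoPlusTiltZFour
import Summits.BirchSwinnertonDyer.BirchSwinnertonDyer.Theorems.ResidualThetaTransportAtTwoRelativeLubinTateBase
import Literature.NumberTheory.EllipticCurves.SupersingularFormalMulFrobenius
import Literature.NumberTheory.EllipticCurves.SupersingularPrimeFieldPointCount
import HarnessLib

/-!
# Seed crux `SignedMuSeedAtTwoPlus` (stmt-BirchSwinnertonDyer-21438), line `norm-field-tilt`:
# the TILT CURVE `y² + y = x³` over `ℤ₄ = 𝒪_{ℚ₂(ζ₃)}` IS a relative Lubin–Tate model for `(π, q) = (−2, 4)`,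
# and the tilt engine runs on it (TiltKernel.md §3 item 1(i) discharged)

Cell `bsd-wall`, width seat `bsd-wall-rtt-p4-w2` g13 (`--supports`, closes nothing).  HONEST FRAMING: THEOREMS ONLY (no definition,
no named fact, no instance, no `sorry`); the line `norm-field-tilt` is NOT registered (W-79); crux Kμ⁺ 20689 and seed 21438 stay OPEN;
BSD is not proved by any of this.

WHAT.  `U := ⟨0, 0, 1, 0, 0⟩` (the Weierstrass equation `y² + y = x³`, `a₃ = 1`, all other `aᵢ = 0`) over various rings:
* §1 over `𝔽₂`: `#U(𝔽₂) = 3` (tree `DeuringHasse.exercise_5_10_d'`) so `tr(U/𝔽₂) = 0` (`tr_tiltCurve_zmod_two`); hence by the tree's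
  supersingular Frobenius identity (`formalMul_prime_eq_formalNeg_subst_of_tr_eq_zero`, Honda/Serre) **`[2]˜ = ĩ(X⁴)`** and
  **`ĩ([2]˜X) = X⁴`** (`formalNeg_subst_formalMul_two_zmod_two`: `[−2]` IS the `4`-Frobenius on `Û ⊗ 𝔽₂`);
* §2 over `ℤ` and over EVERY commutative ring: `2 ∣ [Xⁿ] i([2]X) − δ_{n,4}` (`two_dvd_coeff_formalNeg_subst_formalMul_two_sub`), i.e. the
  hypothesis `hU` of the RTT file `…RelativeLubinTateBase` §2; so over every Lubin–Tate base `A` for `(−2, 4)`: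
  `f_U := i([2]X) ∈ 𝔉_{−2}` (`isLTSeries_tiltCurve`) and **`U.formalGroupLaw = LubinTate.ltF hA hf_U`** (`formalGroupLaw_tiltCurve_eq_ltF`);
  in characteristic `2`: `i([2]X) = X⁴` and `[2]X = i(X⁴)` on the nose (`formalNeg_subst_formalMul_two_of_charP`, `formalMul_two_of_charP`);
* §3 over `ℤ₄ = LubinTate.unitBall ℚ_[2]⟮ζ₃⟯` (RTT `isLTRing_unitBall_adjoin_zeta`): the tilt engine `oddDigit_of_nonDeg_zFour` (p660697) with
  its inputs `f, hf, U, hU, ha₁` DISCHARGED and `η̄ = 1` (`formalEta_eq_one`): **`oddDigit_of_nonDeg_tiltCurve`**.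

What is NOT here: the series `θ = θ̄^ρ` (reduced Robert function, stub S1 (ii)), the membership/digits (S1 (iii)), `NonDeg` (stub S4).

References: [LubinTate1965] §1; [Serre1972] §1.11; [SilvermanAEC2009] IV.2, Ex. V.5.10 (d); [deShalit1987] Ch. I §1.
-/

noncomputable section

set_option autoImplicit false
-- the Theorems namespace of this sub repeats the summit name by design (D-0017 nested layout)
set_option linter.dupNamespace false

open scoped Classical IntermediateField
open PowerSeries WeierstrassCurve
open Literature.NumberTheory.EllipticCurves
open Literature.NumberTheory.GaloisRepresentations
open Summit.BirchSwinnertonDyer.BirchSwinnertonDyer.Theorems.RelativeLubinTate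
open Summit.BirchSwinnertonDyer.BirchSwinnertonDyer.Theorems.RelativeLubinTate.ZFour

namespace Summit.BirchSwinnertonDyer.BirchSwinnertonDyer.Theorems.SignedMuAtTwo.Tilt

/-! ## §1 The tilt curve over `𝔽₂`: `tr = 0`, `[2]˜ = ĩ(X⁴)`, `ĩ([2]˜X) = X⁴` -/

/-- `⟨0, 0, 1, 0, 0⟩` is defined over `ℤ`: it is its own image under every ring map. [folklore] -/
theorem map_tiltCurve {R S : Type*} [CommRing R] [CommRing S] (φ : R →+* S) :
    (⟨0, 0, 1, 0, 0⟩ : WeierstrassCurve R).map φ = ⟨0, 0, 1, 0, 0⟩ := by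
  simp [WeierstrassCurve.map]

/-- `Δ(y² + y = x³) = −27`. [cite: SilvermanAEC2009, III.1] -/
theorem Δ_tiltCurve {R : Type*} [CommRing R] : (⟨0, 0, 1, 0, 0⟩ : WeierstrassCurve R).Δ = -27 := by
  simp [WeierstrassCurve.Δ, WeierstrassCurve.b₂, WeierstrassCurve.b₄, WeierstrassCurve.b₆, WeierstrassCurve.b₈]

/-- `y² + y = x³` is an elliptic curve over `ℚ₂` (`Δ = −27 ≠ 0`). [cite: SilvermanAEC2009, III.1] -/
theorem isElliptic_tiltCurve_padic : (⟨0, 0, 1, 0, 0⟩ : WeierstrassCurve ℚ_[2]).IsElliptic :=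
  ⟨isUnit_iff_ne_zero.mpr (by rw [Δ_tiltCurve]; norm_num)⟩

/-- `#U(𝔽₂) = 3` for `U : y² + y = x³` (points `O`, `(0,0)`, `(0,1)`). [cite: SilvermanAEC2009, Exercise V.5.10 (d)] -/
theorem natCard_point_tiltCurve_zmod_two :
    Nat.card (⟨0, 0, 1, 0, 0⟩ : WeierstrassCurve (ZMod 2)).toAffine.Point = 3 :=
  DeuringHasse.exercise_5_10_d'.1

/-- **`tr(U/𝔽₂) = 2 + 1 − #U(𝔽₂) = 0`**: `y² + y = x³` is supersingular at `2` with `a₂ = 0`.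
[cite: SilvermanAEC2009, Exercise V.5.10 (d)] -/
theorem tr_tiltCurve_zmod_two : HasseManin.tr (⟨0, 0, 1, 0, 0⟩ : WeierstrassCurve (ZMod 2)) = 0 := by
  rw [HasseManin.tr, natCard_point_tiltCurve_zmod_two, ZMod.card]
  norm_num

/-- **`[2]˜(X) = ĩ(X⁴)` on `Û ⊗ 𝔽₂`** (`[2] = −φ²`, the tree's supersingular Frobenius identity at `a₂ = 0`).
[cite: Serre1972, §1.11] [cite: SilvermanAEC2009, Thm. V.2.3.1(b)] -/
theorem formalMul_two_zmod_two :
    (⟨0, 0, 1, 0, 0⟩ : WeierstrassCurve (ZMod 2)).formalMul 2 =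
      (⟨0, 0, 1, 0, 0⟩ : WeierstrassCurve (ZMod 2)).formalNeg.subst ((X : (ZMod 2)⟦X⟧) ^ 2 ^ 2) := by
  haveI : ((⟨0, 0, 1, 0, 0⟩ : WeierstrassCurve ℤ_[2]).map PadicInt.Coe.ringHom).IsElliptic := by
    rw [map_tiltCurve]; exact isElliptic_tiltCurve_padic
  haveI : ((⟨0, 0, 1, 0, 0⟩ : WeierstrassCurve ℤ_[2]).map PadicInt.toZMod).IsElliptic := by
    -- `Δ = −27 = 1` in `𝔽₂` (cf. the tree's `FunctionField.isElliptic_zmod_two`, not imported to keep this file light)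
    rw [map_tiltCurve]; exact ⟨isUnit_iff_ne_zero.mpr (by rw [Δ_tiltCurve]; decide)⟩
  have htr : HasseManin.tr ((⟨0, 0, 1, 0, 0⟩ : WeierstrassCurve ℤ_[2]).map PadicInt.toZMod) = 0 := by
    rw [map_tiltCurve]; exact tr_tiltCurve_zmod_two
  have h := formalMul_prime_eq_formalNeg_subst_of_tr_eq_zero (p := 2) (⟨0, 0, 1, 0, 0⟩ : WeierstrassCurve ℤ_[2]) htr
  simpa only [map_tiltCurve] using h

/-- **`ĩ([2]˜X) = X⁴` on `Û ⊗ 𝔽₂`**: `[−2]` is the `4`-Frobenius (`ĩ ∘ ĩ = id`). [cite: Serre1972, §1.11] [cite: LubinTate1965, §1] -/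
theorem formalNeg_subst_formalMul_two_zmod_two :
    (⟨0, 0, 1, 0, 0⟩ : WeierstrassCurve (ZMod 2)).formalNeg.subst ((⟨0, 0, 1, 0, 0⟩ : WeierstrassCurve (ZMod 2)).formalMul 2) =
      (X : (ZMod 2)⟦X⟧) ^ 2 ^ 2 := by
  have hX : HasSubst ((X : (ZMod 2)⟦X⟧) ^ 2 ^ 2) := HasSubst.X_pow (by norm_num)
  rw [formalMul_two_zmod_two, ← subst_comp_subst_apply (hasSubst_formalNeg _) hX, formalNeg_subst_formalNeg_eq_X, subst_X hX]

/-! ## §2 Over `ℤ` and over every commutative ring: `i([2]X) ≡ X⁴ (mod 2)`; Lubin–Tate over every base for `(−2, 4)` -/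

/-- Over `ℤ`: `2 ∣ [Xⁿ] i([2]X) − δ_{n,4}` for `y² + y = x³`. [cite: LubinTate1965, §1] [cite: Serre1972, §1.11] -/
theorem two_dvd_coeff_formalNeg_subst_formalMul_two_sub_int (n : ℕ) :
    (2 : ℤ) ∣ coeff n ((⟨0, 0, 1, 0, 0⟩ : WeierstrassCurve ℤ).formalNeg.subst ((⟨0, 0, 1, 0, 0⟩ : WeierstrassCurve ℤ).formalMul 2)) -
      (if n = 2 ^ 2 then 1 else 0) := by
  rw [show (2 : ℤ) = ((2 : ℕ) : ℤ) by norm_num, ← ZMod.intCast_zmod_eq_zero_iff_dvd]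
  have hmap : PowerSeries.map (Int.castRingHom (ZMod 2))
      ((⟨0, 0, 1, 0, 0⟩ : WeierstrassCurve ℤ).formalNeg.subst ((⟨0, 0, 1, 0, 0⟩ : WeierstrassCurve ℤ).formalMul 2)) =
        (X : (ZMod 2)⟦X⟧) ^ 2 ^ 2 := by
    rw [map_formalNeg_subst_formalMul', map_tiltCurve, formalNeg_subst_formalMul_two_zmod_two]
  have hc := congrArg (coeff n) hmap
  rw [coeff_map, coeff_X_pow] at hc
  have hc' : ((coeff n ((⟨0, 0, 1, 0, 0⟩ : WeierstrassCurve ℤ).formalNeg.subst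
      ((⟨0, 0, 1, 0, 0⟩ : WeierstrassCurve ℤ).formalMul 2)) : ℤ) : ZMod 2) = if n = 2 ^ 2 then 1 else 0 := hc
  rw [Int.cast_sub, hc']
  split_ifs <;> simp

/-- **Over EVERY commutative ring `R`: `2 ∣ [Xⁿ] i_U([2]_U X) − δ_{n,4}`** for `U = (y² + y = x³)/R` — the hypothesis `hU` of
`RelativeLubinTate.isLTSeries_of_dvd` / `formalGroupLaw_eq_ltF'` with `p = 2`. [cite: LubinTate1965, §1] [cite: Serre1972, §1.11] -/
theorem two_dvd_coeff_formalNeg_subst_formalMul_two_sub {R : Type*} [CommRing R] (n : ℕ) :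
    ((2 : ℕ) : R) ∣ coeff n ((⟨0, 0, 1, 0, 0⟩ : WeierstrassCurve R).formalNeg.subst ((⟨0, 0, 1, 0, 0⟩ : WeierstrassCurve R).formalMul 2)) -
      (if n = 2 ^ 2 then 1 else 0) := by
  have hmap : PowerSeries.map (Int.castRingHom R)
      ((⟨0, 0, 1, 0, 0⟩ : WeierstrassCurve ℤ).formalNeg.subst ((⟨0, 0, 1, 0, 0⟩ : WeierstrassCurve ℤ).formalMul 2)) =
        (⟨0, 0, 1, 0, 0⟩ : WeierstrassCurve R).formalNeg.subst ((⟨0, 0, 1, 0, 0⟩ : WeierstrassCurve R).formalMul 2) := by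
    rw [map_formalNeg_subst_formalMul', map_tiltCurve]
  have hc := congrArg (coeff n) hmap
  rw [coeff_map] at hc
  have hd := map_dvd (Int.castRingHom R) (two_dvd_coeff_formalNeg_subst_formalMul_two_sub_int n)
  rw [map_sub, hc] at hd
  convert hd using 2
  · simp
  · split_ifs <;> simp

/-- **`f_U := i_U([2]_U X)` is a Lubin–Tate series for `(π, q) = (−2, 4)`** over every commutative ring, `U = (y² + y = x³)`.
[cite: LubinTate1965, §1 Lemma 1] [cite: Serre1972, §1.11] -/
theorem isLTSeries_tiltCurve (R : Type*) [CommRing R] :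
    LubinTate.IsLTSeries (-((2 : ℕ) : R)) (2 ^ 2)
      ((⟨0, 0, 1, 0, 0⟩ : WeierstrassCurve R).formalNeg.subst ((⟨0, 0, 1, 0, 0⟩ : WeierstrassCurve R).formalMul 2)) :=
  isLTSeries_of_dvd _ two_dvd_coeff_formalNeg_subst_formalMul_two_sub

/-- **The formal group of `U = (y² + y = x³)` over ANY Lubin–Tate base `A` for `(−2, 4)` IS Lubin–Tate's `F_{f_U}`**,
`f_U = i_U([2]_U X)`: `U.formalGroupLaw = LubinTate.ltF hA hf_U`. [cite: LubinTate1965, §1 Thm. 1] [cite: deShalit1987, Ch. I §1] -/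
theorem formalGroupLaw_tiltCurve_eq_ltF {A : Type*} [CommRing A] (hA : LubinTate.IsLTRing (-((2 : ℕ) : A)) (2 ^ 2)) :
    (⟨0, 0, 1, 0, 0⟩ : WeierstrassCurve A).formalGroupLaw = LubinTate.ltF hA (isLTSeries_tiltCurve A) :=
  formalGroupLaw_eq_ltF' _ hA two_dvd_coeff_formalNeg_subst_formalMul_two_sub

/-- In characteristic `2`: **`i_U([2]_U X) = X⁴`** exactly (`[−2] = φ²` on `Û`, `U = (y² + y = x³)`). [cite: Serre1972, §1.11] -/
theorem formalNeg_subst_formalMul_two_of_charP {k : Type*} [CommRing k] [CharP k 2] :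
    (⟨0, 0, 1, 0, 0⟩ : WeierstrassCurve k).formalNeg.subst ((⟨0, 0, 1, 0, 0⟩ : WeierstrassCurve k).formalMul 2) =
      (X : k⟦X⟧) ^ 2 ^ 2 := by
  have hmap : PowerSeries.map (ZMod.castHom (dvd_refl 2) k)
      ((⟨0, 0, 1, 0, 0⟩ : WeierstrassCurve (ZMod 2)).formalNeg.subst ((⟨0, 0, 1, 0, 0⟩ : WeierstrassCurve (ZMod 2)).formalMul 2)) =
        (⟨0, 0, 1, 0, 0⟩ : WeierstrassCurve k).formalNeg.subst ((⟨0, 0, 1, 0, 0⟩ : WeierstrassCurve k).formalMul 2) := by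
    rw [map_formalNeg_subst_formalMul', map_tiltCurve]
  rw [← hmap, formalNeg_subst_formalMul_two_zmod_two, map_pow, map_X]

/-- In characteristic `2`: **`[2]_U X = i_U(X⁴)`** (`[2] = −φ²` on `Û`, `U = (y² + y = x³)`). [cite: Serre1972, §1.11]
[cite: SilvermanAEC2009, Thm. V.2.3.1(b)] -/
theorem formalMul_two_of_charP {k : Type*} [CommRing k] [CharP k 2] :
    (⟨0, 0, 1, 0, 0⟩ : WeierstrassCurve k).formalMul 2 =
      (⟨0, 0, 1, 0, 0⟩ : WeierstrassCurve k).formalNeg.subst ((X : k⟦X⟧) ^ 2 ^ 2) := by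
  have hmap : PowerSeries.map (ZMod.castHom (dvd_refl 2) k) ((⟨0, 0, 1, 0, 0⟩ : WeierstrassCurve (ZMod 2)).formalMul 2) =
      (⟨0, 0, 1, 0, 0⟩ : WeierstrassCurve k).formalMul 2 := by
    rw [map_formalMul, map_tiltCurve]
  have hX : HasSubst ((X : (ZMod 2)⟦X⟧) ^ 2 ^ 2) := HasSubst.X_pow (by norm_num)
  rw [← hmap, formalMul_two_zmod_two, powerSeries_map_subst _ hX, map_formalNeg, map_tiltCurve, map_pow, map_X]

/-! ## §3 Over `ℤ₄ = 𝒪_{ℚ₂(ζ₃)}`: the tilt engine runs on the tilt curve -/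

section ZFour

variable {ζ : PadicAlgCl 2} (hζ : ζ ^ 2 + ζ + 1 = 0)

/-- `a₁(U mod (−2)) = 0` for `U = (y² + y = x³)/ℤ₄`. [folklore] -/
theorem a₁_map_tiltCurve_eq_zero :
    ((⟨0, 0, 1, 0, 0⟩ : WeierstrassCurve (LubinTate.unitBall (↥ℚ_[2]⟮ζ⟯))).map
      (Ideal.Quotient.mk (Ideal.span {-((2 : ℕ) : LubinTate.unitBall (↥ℚ_[2]⟮ζ⟯))}))).a₁ = 0 := by
  rw [map_tiltCurve]

include hζ in
/-- The residue ring `ℤ₄/(−2)` (`= 𝔽₄`) has characteristic `2`. [cite: SerreLocalFields1979, Ch. I §6] -/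
theorem charP_two_quotient_neg_two :
    CharP (LubinTate.unitBall (↥ℚ_[2]⟮ζ⟯) ⧸ Ideal.span {-((2 : ℕ) : LubinTate.unitBall (↥ℚ_[2]⟮ζ⟯))}) 2 := by
  haveI := isDomain_quotient_neg_two hζ
  have h2 : Ideal.Quotient.mk (Ideal.span {-((2 : ℕ) : LubinTate.unitBall (↥ℚ_[2]⟮ζ⟯))})
      (2 : LubinTate.unitBall (↥ℚ_[2]⟮ζ⟯)) = 0 :=
    Ideal.Quotient.eq_zero_iff_mem.mpr (Ideal.mem_span_singleton.mpr ⟨-1, by rw [Nat.cast_ofNat]; ring⟩)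
  exact CharTwo.of_one_ne_zero_of_two_eq_zero one_ne_zero
    ((map_ofNat (Ideal.Quotient.mk (Ideal.span {-((2 : ℕ) : LubinTate.unitBall (↥ℚ_[2]⟮ζ⟯))})) 2).symm.trans h2)

include hζ in
/-- **`η̄ = 1` for the tilt curve**: the inverse invariant differential of `U ⊗ ℤ₄/(−2)` is `1`, so the invariant derivation of the
engine is the plain derivative `d/dt̄` (`formalEta_eq_one` of p657707, `a₁ = a₂ = a₄ = a₆ = 0`). [folklore] -/
theorem formalEta_map_tiltCurve_eq_one :
    (((⟨0, 0, 1, 0, 0⟩ : WeierstrassCurve (LubinTate.unitBall (↥ℚ_[2]⟮ζ⟯))).map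
      (Ideal.Quotient.mk (Ideal.span {-((2 : ℕ) : LubinTate.unitBall (↥ℚ_[2]⟮ζ⟯))})))).formalEta = 1 := by
  haveI := charP_two_quotient_neg_two hζ
  rw [map_tiltCurve]
  exact formalEta_eq_one _ rfl rfl rfl rfl

/-- **`Û = F_{f_U}` over `ℤ₄`**: the formal group law of `U = (y² + y = x³)/𝒪_{ℚ₂(ζ₃)}` is Lubin–Tate's `F_f` for
`f = f_U = i_U([2]_U X) ∈ 𝔉_{−2}` over the Lubin–Tate base `(𝒪_{ℚ₂(ζ₃)}, −2, 4)` of `isLTRing_unitBall_adjoin_zeta` — the hypothesis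
`hU` of `oddDigit_of_nonDeg_zFour` for the ACTUAL tilt curve. [cite: LubinTate1965, §1 Thm. 1] [cite: deShalit1987, Ch. I §1] -/
theorem formalGroupLaw_tiltCurve_zFour_eq_ltF :
    (⟨0, 0, 1, 0, 0⟩ : WeierstrassCurve (LubinTate.unitBall (↥ℚ_[2]⟮ζ⟯))).formalGroupLaw =
      LubinTate.ltF (isLTRing_unitBall_adjoin_zeta hζ) (isLTSeries_tiltCurve (LubinTate.unitBall (↥ℚ_[2]⟮ζ⟯))) :=
  formalGroupLaw_tiltCurve_eq_ltF (isLTRing_unitBall_adjoin_zeta hζ)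

include hζ in
/-- **The tilt engine ON THE TILT CURVE** (`oddDigit_of_nonDeg_zFour`, p660697, with its inputs `f`, `hf`, `U`, `hU`, `ha₁` DISCHARGED:
`U = (y² + y = x³)/ℤ₄`, `f = i_U([2]_U X)`, `Û = F_f`, `a₁ = 0`, and `η̄ = 1`).  Remaining inputs, verbatim from the engine:
`g = 1 − 2·w₀` with `w₀, w₀ − 1 ∉ (2)` (`N(g) = −1`); a series `θ ∈ 𝔽₄⟦t̄⟧` of order `4` (stub S1 (ii): `θ̄^ρ`);
`Z_m := ∏_{j<2^m} θ([gʲ]_f‾ t̄)`, `S_m` with `Z_m·S_m = Z_m'` (plain derivative), digits `Z_m ≡ P_m(s_m) (mod t̄^{3·4^m})` (S1 (iii));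
`ord S_{m₀} = a₀` with `a₀ + 2 < 4^{m₀+1}` (stub S4).  Output: for every `m ≥ m₀ + 2` some odd-degree coefficient of `P_m` is non-zero.
[folklore] -/
theorem oddDigit_of_nonDeg_tiltCurve
    {g w₀ : LubinTate.unitBall (↥ℚ_[2]⟮ζ⟯)} (hg : g = 1 + -((2 : ℕ) : LubinTate.unitBall (↥ℚ_[2]⟮ζ⟯)) * w₀)
    (hw₀ : w₀ ∉ Ideal.span {-((2 : ℕ) : LubinTate.unitBall (↥ℚ_[2]⟮ζ⟯))})
    (hw₀' : w₀ + (-1) ∉ Ideal.span {-((2 : ℕ) : LubinTate.unitBall (↥ℚ_[2]⟮ζ⟯))})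
    {θ : PowerSeries (LubinTate.unitBall (↥ℚ_[2]⟮ζ⟯) ⧸ Ideal.span {-((2 : ℕ) : LubinTate.unitBall (↥ℚ_[2]⟮ζ⟯))})}
    (hθ : θ.order = (4 : ℕ))
    (S s : ℕ → PowerSeries (LubinTate.unitBall (↥ℚ_[2]⟮ζ⟯) ⧸ Ideal.span {-((2 : ℕ) : LubinTate.unitBall (↥ℚ_[2]⟮ζ⟯))}))
    (P : ℕ → Polynomial (LubinTate.unitBall (↥ℚ_[2]⟮ζ⟯) ⧸ Ideal.span {-((2 : ℕ) : LubinTate.unitBall (↥ℚ_[2]⟮ζ⟯))}))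
    (hZS : ∀ m, (∏ j ∈ Finset.range (2 ^ m),
        (θ.subst ((LubinTate.hom (isLTRing_unitBall_adjoin_zeta hζ)
          (isLTSeries_tiltCurve (LubinTate.unitBall (↥ℚ_[2]⟮ζ⟯))) (isLTSeries_tiltCurve (LubinTate.unitBall (↥ℚ_[2]⟮ζ⟯)))
          (g ^ j)).map (Ideal.Quotient.mk (Ideal.span {-((2 : ℕ) : LubinTate.unitBall (↥ℚ_[2]⟮ζ⟯))}))) :
          PowerSeries (LubinTate.unitBall (↥ℚ_[2]⟮ζ⟯) ⧸ Ideal.span {-((2 : ℕ) : LubinTate.unitBall (↥ℚ_[2]⟮ζ⟯))}))) * S m =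
        d⁄dX (LubinTate.unitBall (↥ℚ_[2]⟮ζ⟯) ⧸ Ideal.span {-((2 : ℕ) : LubinTate.unitBall (↥ℚ_[2]⟮ζ⟯))})
          (∏ j ∈ Finset.range (2 ^ m),
            (θ.subst ((LubinTate.hom (isLTRing_unitBall_adjoin_zeta hζ)
              (isLTSeries_tiltCurve (LubinTate.unitBall (↥ℚ_[2]⟮ζ⟯))) (isLTSeries_tiltCurve (LubinTate.unitBall (↥ℚ_[2]⟮ζ⟯)))
              (g ^ j)).map (Ideal.Quotient.mk (Ideal.span {-((2 : ℕ) : LubinTate.unitBall (↥ℚ_[2]⟮ζ⟯))}))) :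
              PowerSeries (LubinTate.unitBall (↥ℚ_[2]⟮ζ⟯) ⧸ Ideal.span {-((2 : ℕ) : LubinTate.unitBall (↥ℚ_[2]⟮ζ⟯))}))))
    (hmem : ∀ m, (X : PowerSeries (LubinTate.unitBall (↥ℚ_[2]⟮ζ⟯) ⧸
        Ideal.span {-((2 : ℕ) : LubinTate.unitBall (↥ℚ_[2]⟮ζ⟯))})) ^ (3 * 4 ^ m) ∣
      (∏ j ∈ Finset.range (2 ^ m),
        (θ.subst ((LubinTate.hom (isLTRing_unitBall_adjoin_zeta hζ)
          (isLTSeries_tiltCurve (LubinTate.unitBall (↥ℚ_[2]⟮ζ⟯))) (isLTSeries_tiltCurve (LubinTate.unitBall (↥ℚ_[2]⟮ζ⟯)))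
          (g ^ j)).map (Ideal.Quotient.mk (Ideal.span {-((2 : ℕ) : LubinTate.unitBall (↥ℚ_[2]⟮ζ⟯))}))) :
          PowerSeries (LubinTate.unitBall (↥ℚ_[2]⟮ζ⟯) ⧸ Ideal.span {-((2 : ℕ) : LubinTate.unitBall (↥ℚ_[2]⟮ζ⟯))}))) -
        Polynomial.aeval (s m) (P m))
    {m₀ a₀ : ℕ} (ha₀ : (S m₀).order = a₀) (hnd : a₀ + 2 < 4 ^ (m₀ + 1))
    {m : ℕ} (hm : m₀ + 2 ≤ m) : ∃ i, Odd i ∧ (P m).coeff i ≠ 0 := by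
  refine oddDigit_of_nonDeg_zFour hζ (isLTSeries_tiltCurve (LubinTate.unitBall (↥ℚ_[2]⟮ζ⟯))) ⟨0, 0, 1, 0, 0⟩
    (formalGroupLaw_tiltCurve_zFour_eq_ltF hζ) a₁_map_tiltCurve_eq_zero hg hw₀ hw₀' hθ S s P (fun m => ?_) hmem ha₀ hnd hm
  have hη := formalEta_map_tiltCurve_eq_one hζ
  exact (hZS m).trans (((one_mul _).symm).trans (congrArg (fun e => e * _) hη.symm))

end ZFour

end Summit.BirchSwinnertonDyer.BirchSwinnertonDyer.Theorems.SignedMuAtTwo.Tilt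

end
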